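import Literature.Analysis.FluidPDE.ClassicalNSFourierModes
import Literature.Analysis.FunctionSpaces.TorusSpaceTime
import Literature.Analysis.FunctionSpaces.TorusLinearisedFormTruncation
import Literature.Analysis.FunctionSpaces.TorusEnstrophyOrthogonality
import Summits.AnomalousDissipation.AnomalousDissipation.Theorems.ImpulseGridGridInjectionIdentity
import Literature.Analysis.FluidPDE.DoeringFoiasPowerProofs
import Summits.AnomalousDissipation.AnomalousDissipation.Theorems.DopplerClockLongitudinalClassQuietODE

/-!
# Route DopplerClock (AnomalousDissipation) — support item `LongitudinalClassQuiet`
# (stmt-AnomalousDissipation-18134), step 1: the cross-plane field of an `x₀`-invariant flow relaxes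

Let `(u, p)` be a classical solution of the forced Navier–Stokes system on `[0, ∞) × T³` whose
force is everywhere parallel to `e₀` (`f = f₀ e₀`), which is invariant under all translations
along the `x₀`-circle, and whose momentum is a constant vector `c` with `c₀ = 0`
(`∫ u(t) = c`, `t ≥ 0`). Put `W(t, x) = u(t, x) − u₀(t, x) e₀ − c` (the cross-plane fluctuation,
`W₀ ≡ 0`). Then

* `hasDerivWithinAt_crossPlaneEnergy` — `d/dt ∫ ‖W(t)‖² = −2ν ‖∇W(t)‖₂²` within `[0, ∞)`: the
  projected energy identity. Differentiate under the integral
  (`Torus.IsSmoothSpaceTimeOn.hasDerivWithinAt_integral`), insert the momentum equation; the force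
  term vanishes pointwise (`f ⊥ W`), the pressure term vanishes because `div W = div u − ∂₀u₀ = 0`
  (this is the ONLY place where `x₀`-invariance enters), the convective term by antisymmetry of the
  trilinear form, and `∫ ⟪Δu, W⟫ = ∫ ⟪W, ΔW⟫ = −‖∇W‖₂²` (Temam 1984, Ch. II §1; the planar
  Navier–Stokes energy identity of Majda–Bertozzi 2002, §2.3.1, written on `T³`);
* `tendsto_crossPlaneEnergy_zero` — hence, by the Poincaré inequality for the mean-zero field `W(t)`
  (`Torus.four_pi_sq_mul_integral_norm_sq_le_gradNormSq`), `∫ ‖W(t)‖² ≤ ∫ ‖W(0)‖² e^{−8π²ν t} → 0`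
  (`LongitudinalQuiet.tendsto_zero_of_deriv_le_neg_mul_add`).

References: R. Temam, *Navier–Stokes Equations* (1984), Ch. II §1.2 Lemma 1.3, Ch. III §1;
A. Majda, A. Bertozzi, *Vorticity and Incompressible Flow* (2002), §2.3.1 (2½-dimensional flows);
C. Foias, O. Manley, R. Rosa, R. Temam, *Navier–Stokes Equations and Turbulence* (2001), Ch. II
(momentum, Galilean frames). No new definitions. Supports stmt-AnomalousDissipation-18134.
-/

noncomputable section

-- `Summit.<Summit>.<Problem>` is the tree's mandated summit-side namespace (CONVENTIONS §2); for this
-- single-conjunct summit the two coincide, so the duplicate is deliberate.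
set_option linter.dupNamespace false

open MeasureTheory Set Filter Topology
open scoped InnerProductSpace RealInnerProductSpace ContDiff

namespace Summit.AnomalousDissipation.AnomalousDissipation.Theorems

open Literature.Analysis.FluidPDE Literature.Analysis.FluidPDE.Torus
open Literature.Analysis.FunctionSpaces Literature.Analysis.FunctionSpaces.Torus

namespace LongitudinalQuiet

variable {ν : ℝ} {f u : ℝ → UnitAddTorus (Fin 3) → EuclideanSpace ℝ (Fin 3)}
  {p : ℝ → UnitAddTorus (Fin 3) → ℝ} {c : EuclideanSpace ℝ (Fin 3)}

/-! ### Pointwise facts about the cross-plane fluctuation `W = u − u₀ e₀ − c` -/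

/-- The cross-plane fluctuation has no `e₀`-component: `W₀ = 0` when `c₀ = 0`. [folklore] -/
theorem crossPlane_apply_zero (v : EuclideanSpace ℝ (Fin 3)) (hc : c 0 = 0) :
    (v - (v 0) • EuclideanSpace.single (0 : Fin 3) (1 : ℝ) - c) 0 = 0 := by
  simp [hc]

/-- `⟪a₀ e₀, W⟫ = 0`: vectors parallel to `e₀` are orthogonal to the cross-plane fluctuation. [folklore] -/
theorem inner_smul_single_crossPlane (a : ℝ) (v : EuclideanSpace ℝ (Fin 3)) (hc : c 0 = 0) :
    ⟪a • EuclideanSpace.single (0 : Fin 3) (1 : ℝ),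
      v - (v 0) • EuclideanSpace.single (0 : Fin 3) (1 : ℝ) - c⟫ = 0 := by
  rw [real_inner_smul_left, EuclideanSpace.inner_single_left, crossPlane_apply_zero v hc]
  simp

/-! ### Slice calculus for the cross-plane fluctuation of a smooth field -/

section Slice

variable {v : UnitAddTorus (Fin 3) → EuclideanSpace ℝ (Fin 3)}

/-- The cross-plane fluctuation of a smooth field is smooth. [folklore] -/
theorem isSmooth_crossPlane (hv : IsSmooth v) (c : EuclideanSpace ℝ (Fin 3)) :
    IsSmooth (fun y => v y - (v y 0) • EuclideanSpace.single (0 : Fin 3) (1 : ℝ) - c) :=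
  (hv.sub ((hv.apply 0).smul' (isSmooth_const _))).sub (isSmooth_const c)

/-- Partial derivatives of the cross-plane fluctuation: `∂ᵢ W = ∂ᵢ v − (∂ᵢ v₀) e₀`. [folklore] -/
theorem partialDeriv_crossPlane (hv : IsSmooth v) (c : EuclideanSpace ℝ (Fin 3)) (i : Fin 3)
    (x : UnitAddTorus (Fin 3)) :
    partialDeriv i (fun y => v y - (v y 0) • EuclideanSpace.single (0 : Fin 3) (1 : ℝ) - c) x =
      partialDeriv i v x -
        (partialDeriv i (fun y => v y 0) x) • EuclideanSpace.single (0 : Fin 3) (1 : ℝ) := by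
  have h1 := hv.hasDerivAt_line_zero i x
  have h2 := ((hv.apply 0).hasDerivAt_line_zero i x).smul_const
    (EuclideanSpace.single (0 : Fin 3) (1 : ℝ))
  have h := (h1.sub h2).sub_const c
  exact h.deriv

/-- **The cross-plane fluctuation of an `x₀`-invariant divergence-free field is divergence free**:
`div W = div v − ∂₀ v₀ = 0`. [folklore] -/
theorem isDivFree_crossPlane (hv : IsSmooth v) (hdiv : IsDivFree v)
    (hinv : ∀ (s : UnitAddCircle) (y : UnitAddTorus (Fin 3)), v (y + Pi.single 0 s) = v y)
    (c : EuclideanSpace ℝ (Fin 3)) :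
    IsDivFree (fun y => v y - (v y 0) • EuclideanSpace.single (0 : Fin 3) (1 : ℝ) - c) := by
  intro x
  have hW := isSmooth_crossPlane hv c
  have h0 : partialDeriv 0 (fun y => v y 0) x = 0 :=
    GridInjection.partialDeriv_eq_zero_of_forall_add_single (fun s y => by rw [hinv s y]) x
  have hd := hdiv x
  rw [divergence_eq_sum_partialDeriv_apply (hv.isContDiff (by simp))] at hd
  rw [divergence_eq_sum_partialDeriv_apply (hW.isContDiff (by simp))]
  simp_rw [partialDeriv_crossPlane hv c]
  rw [Fin.sum_univ_three] at hd ⊢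
  rw [h0]
  simp only [PiLp.sub_apply, PiLp.smul_apply, PiLp.single_apply, smul_eq_mul]
  simp only [Fin.isValue, ↓reduceIte, mul_one, mul_zero, sub_zero,
    show (1 : Fin 3) ≠ 0 from by decide, show (2 : Fin 3) ≠ 0 from by decide]
  linarith

/-- The pressure does no work on the cross-plane fluctuation: `∫ ⟪∇q, W⟫ = 0`. [folklore] -/
theorem integral_inner_gradient_crossPlane (hv : IsSmooth v) (hdiv : IsDivFree v)
    (hinv : ∀ (s : UnitAddCircle) (y : UnitAddTorus (Fin 3)), v (y + Pi.single 0 s) = v y)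
    {q : UnitAddTorus (Fin 3) → ℝ} (hq : IsSmooth q) (c : EuclideanSpace ℝ (Fin 3)) :
    ∫ x, ⟪gradient q x, v x - (v x 0) • EuclideanSpace.single (0 : Fin 3) (1 : ℝ) - c⟫ = 0 :=
  integral_inner_gradient_eq_zero_of_isDivFree (isSmooth_crossPlane hv c) hq
    (isDivFree_crossPlane hv hdiv hinv c)

/-- The `j`-th component of the Laplacian of a smooth field whose `j`-th component vanishes
identically is zero (`(Δw)ⱼ = Δ(wⱼ)`, Mathlib `ContDiffAt.laplacian_CLM_comp_left`). [folklore] -/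
theorem laplacian_apply_eq_zero_of_apply_eq_zero {w : UnitAddTorus (Fin 3) → EuclideanSpace ℝ (Fin 3)}
    (hw : IsSmooth w) {j : Fin 3} (hw0 : ∀ y, w y j = 0) (x : UnitAddTorus (Fin 3)) :
    laplacian w x j = 0 := by
  -- adapted from `Literature.Analysis.FluidPDE.DuchonRobertPressure.laplacian_apply_coord`
  have h2 : ContDiffAt ℝ 2 (liftAt w x) 0 :=
    ((hw.liftAt x).of_le (WithTop.coe_le_coe.mpr le_top)).contDiffAt
  have key := h2.laplacian_CLM_comp_left
    (l := (EuclideanSpace.proj j : EuclideanSpace ℝ (Fin 3) →L[ℝ] ℝ))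
  -- `key : Δ (l ∘ liftAt w x) 0 = (l ∘ Δ (liftAt w x)) 0`
  have hl : (EuclideanSpace.proj j : EuclideanSpace ℝ (Fin 3) →L[ℝ] ℝ) ∘ liftAt w x =
      fun _ => (0 : ℝ) := by
    funext y
    simp [liftAt_apply, hw0]
  rw [hl, InnerProductSpace.laplacian_const] at key
  have h3 : (EuclideanSpace.proj j : EuclideanSpace ℝ (Fin 3) →L[ℝ] ℝ) (laplacian w x) = 0 := by
    rw [Torus.laplacian]
    exact key.symm
  simpa using h3

/-- **The viscous term on the cross-plane fluctuation**: `∫ ⟪Δv, W⟫ = −‖∇W‖₂²` when `c₀ = 0`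
(Green: `∫ ⟪Δv, W⟫ = ∫ ⟪v, ΔW⟫`, and `v − W = v₀ e₀ + c` pairs to zero with `ΔW` because
`(ΔW)₀ = 0` and `∫ ⟪c, ΔW⟫ = ∫ ⟪Δc, W⟫ = 0`). [folklore] -/
theorem integral_inner_laplacian_crossPlane (hv : IsSmooth v) (hc : c 0 = 0) :
    ∫ x, ⟪laplacian v x, v x - (v x 0) • EuclideanSpace.single (0 : Fin 3) (1 : ℝ) - c⟫ =
      -gradNormSq (fun y => v y - (v y 0) • EuclideanSpace.single (0 : Fin 3) (1 : ℝ) - c) := by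
  set W : UnitAddTorus (Fin 3) → EuclideanSpace ℝ (Fin 3) :=
    fun y => v y - (v y 0) • EuclideanSpace.single (0 : Fin 3) (1 : ℝ) - c with hWdef
  have hW : IsSmooth W := isSmooth_crossPlane hv c
  have hW0 : ∀ y, W y 0 = 0 := fun y => crossPlane_apply_zero (v y) hc
  -- Green's symmetry
  rw [Torus.integral_inner_laplacian_comm hv hW]
  -- `⟪v, ΔW⟫ = ⟪W, ΔW⟫ + v₀ (ΔW)₀ + ⟪c, ΔW⟫ = ⟪W, ΔW⟫ + ⟪c, ΔW⟫`
  have hpt : ∀ x, ⟪v x, laplacian W x⟫ = ⟪W x, laplacian W x⟫ + ⟪c, laplacian W x⟫ := by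
    intro x
    have hL0 : laplacian W x 0 = 0 := laplacian_apply_eq_zero_of_apply_eq_zero hW hW0 x
    have hv' : v x = W x + (v x 0) • EuclideanSpace.single (0 : Fin 3) (1 : ℝ) + c := by
      simp only [hWdef]; abel
    conv_lhs => rw [hv']
    rw [inner_add_left, inner_add_left, real_inner_smul_left, EuclideanSpace.inner_single_left, hL0]
    simp
  simp_rw [hpt]
  rw [integral_add (hW.inner hW.laplacian).integrable ((isSmooth_const c).inner hW.laplacian).integrable]
  -- `∫ ⟪c, ΔW⟫ = ∫ ⟪Δc, W⟫ = 0`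
  have hc0 : ∫ x, ⟪c, laplacian W x⟫ = 0 := by
    rw [← Torus.integral_inner_laplacian_comm (isSmooth_const c) hW]
    simp [laplacian_fun_const]
  rw [hc0, add_zero, integral_inner_laplacian_eq_neg_holds hW, gradNormSq,
    integral_finsetSum _ fun i _ => (hW.partialDeriv i).norm_sq.integrable]

/-- **The convective term on the cross-plane fluctuation vanishes**: `∫ ⟪(v·∇)v, W⟫ = 0` for
divergence-free `v` and `c₀ = 0` (`∫ ⟪(v·∇)v, W⟫ = −∫ ⟪v, (v·∇)W⟫`, and
`⟪v, (v·∇)W⟫ = ⟪W, (v·∇)W⟫ + v₀ ((v·∇)W)₀ + ⟪c, (v·∇)W⟫` with `((v·∇)W)₀ = 0`,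
`∫ ⟪W, (v·∇)W⟫ = 0` by antisymmetry and `∫ ⟪c, (v·∇)W⟫ = −∫ ⟪(v·∇)c, W⟫ = 0`). [folklore] -/
theorem integral_inner_convect_crossPlane (hv : IsSmooth v) (hdiv : IsDivFree v) (hc : c 0 = 0) :
    ∫ x, ⟪convect v v x, v x - (v x 0) • EuclideanSpace.single (0 : Fin 3) (1 : ℝ) - c⟫ = 0 := by
  set W : UnitAddTorus (Fin 3) → EuclideanSpace ℝ (Fin 3) :=
    fun y => v y - (v y 0) • EuclideanSpace.single (0 : Fin 3) (1 : ℝ) - c with hWdef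
  have hW : IsSmooth W := isSmooth_crossPlane hv c
  have hW0 : ∀ y, W y 0 = 0 := fun y => crossPlane_apply_zero (v y) hc
  rw [integral_inner_convect_eq_neg hv hdiv hv hW, neg_eq_zero]
  have hpt : ∀ x, ⟪v x, convect v W x⟫ = ⟪W x, convect v W x⟫ + ⟪c, convect v W x⟫ := by
    intro x
    have hC0 : convect v W x 0 = 0 :=
      GridInjection.fderiv_apply_coord_eq_zero (hW.isContDiff (by simp)) hW0 x (v x)
    have hv' : v x = W x + (v x 0) • EuclideanSpace.single (0 : Fin 3) (1 : ℝ) + c := by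
      simp only [hWdef]; abel
    conv_lhs => rw [hv']
    rw [inner_add_left, inner_add_left, real_inner_smul_left, EuclideanSpace.inner_single_left, hC0]
    simp
  simp_rw [hpt]
  have i1 : Integrable (fun x => ⟪W x, convect v W x⟫) volume := (hW.inner (hv.convect hW)).integrable
  have i2 : Integrable (fun x => ⟪c, convect v W x⟫) volume :=
    ((isSmooth_const c).inner (hv.convect hW)).integrable
  rw [integral_add i1 i2]
  -- antisymmetry of the trilinear form
  have hA : ∫ x, ⟪W x, convect v W x⟫ = 0 := by
    have h := Torus.integral_inner_convect_add_eq_zero hv hdiv hW hW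
    have hsymm : ∫ x, ⟪convect v W x, W x⟫ = ∫ x, ⟪W x, convect v W x⟫ :=
      integral_congr_ae (ae_of_all _ fun x => real_inner_comm _ _)
    rw [hsymm] at h
    linarith
  have hB : ∫ x, ⟪c, convect v W x⟫ = 0 := by
    have h := integral_inner_convect_eq_neg hv hdiv (isSmooth_const c) hW
    simp only [convect_fun_const, inner_zero_left, integral_zero, zero_eq_neg] at h
    exact h
  rw [hA, hB, add_zero]

end Slice

/-! ### The projected energy identity along a classical solution -/

section Time

variable {ν : ℝ} {f u : ℝ → UnitAddTorus (Fin 3) → EuclideanSpace ℝ (Fin 3)}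
  {p : ℝ → UnitAddTorus (Fin 3) → ℝ} {c : EuclideanSpace ℝ (Fin 3)}

/-- The cross-plane fluctuation of a jointly smooth field is jointly smooth. [folklore] -/
theorem isSmoothSpaceTimeOn_crossPlane {S : Set ℝ} (hu : IsSmoothSpaceTimeOn S u)
    (c : EuclideanSpace ℝ (Fin 3)) :
    IsSmoothSpaceTimeOn S
      (fun s y => u s y - (u s y 0) • EuclideanSpace.single (0 : Fin 3) (1 : ℝ) - c) :=
  (hu.sub ((hu.apply 0).smul (isSmoothSpaceTimeOn_const (isSmooth_const _) S))).sub
    (isSmoothSpaceTimeOn_const (isSmooth_const c) S)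

/-- **Projected energy identity.** For a classical solution on `[0, ∞) × T³` with force parallel
to `e₀`, invariant under `x₀`-translations, and any constant `c` with `c₀ = 0`, the cross-plane
energy `s ↦ ∫ ‖u(s) − u₀(s) e₀ − c‖²` has one-sided derivative `−2ν ‖∇(u(t) − u₀(t) e₀ − c)‖₂²`
within `[0, ∞)` at every `t ≥ 0` (Temam 1984, Ch. III §1 energy method; Majda–Bertozzi 2002,
§2.3.1: the cross-plane field of a 2½-dimensional flow solves unforced planar Navier–Stokes). [folklore] -/
theorem hasDerivWithinAt_crossPlaneEnergy (h : IsClassicalNSSolutionOn (Ici 0) ν f u p)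
    (hf : ∀ t x, f t x = (f t x 0) • EuclideanSpace.single (0 : Fin 3) (1 : ℝ))
    (hinv : ∀ (t : ℝ) (s : UnitAddCircle) (x : UnitAddTorus (Fin 3)), u t (x + Pi.single 0 s) = u t x)
    (hc : c 0 = 0) {t : ℝ} (ht : t ∈ Ici (0 : ℝ)) :
    HasDerivWithinAt
      (fun s => ∫ x, ‖u s x - (u s x 0) • EuclideanSpace.single (0 : Fin 3) (1 : ℝ) - c‖ ^ 2)
      (-(2 * ν) *
        gradNormSq (fun y => u t y - (u t y 0) • EuclideanSpace.single (0 : Fin 3) (1 : ℝ) - c))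
      (Ici 0) t := by
  set S : Set ℝ := Ici 0 with hSdef
  have hS : Convex ℝ S := convex_Ici 0
  have hU : UniqueDiffOn ℝ S := uniqueDiffOn_Ici 0
  have hu : IsSmoothSpaceTimeOn S u := h.smooth_velocity
  set W : ℝ → UnitAddTorus (Fin 3) → EuclideanSpace ℝ (Fin 3) :=
    fun s y => u s y - (u s y 0) • EuclideanSpace.single (0 : Fin 3) (1 : ℝ) - c with hWdef
  have hW : IsSmoothSpaceTimeOn S W := isSmoothSpaceTimeOn_crossPlane hu c
  have hut : IsSmooth (u t) := hu.isSmooth_slice ht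
  have hWt : IsSmooth (W t) := hW.isSmooth_slice ht
  have hpt : IsSmooth (p t) := h.smooth_pressure.isSmooth_slice ht
  -- Step 1: differentiate under the integral sign
  have hφ : IsSmoothSpaceTimeOn S (fun s x => ‖W s x‖ ^ 2) := by
    change ContDiffOn ℝ ∞ (fun z => ‖stLift W z‖ ^ 2) (S ×ˢ univ)
    exact hW.norm_sq ℝ
  have hE := hφ.hasDerivWithinAt_integral hS ht
  have htd : ∀ x, Torus.timeDerivWithin S (fun s x => ‖W s x‖ ^ 2) t x =
      2 * ⟪Torus.timeDerivWithin S W t x, W t x⟫ := by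
    intro x
    have h2 := ((hW.hasDerivWithinAt_slice ht x).norm_sq).derivWithin (hU t ht)
    rw [real_inner_comm] at h2
    exact h2
  -- Step 2: `∂ₜW = ∂ₜu − (∂ₜu)₀ e₀`, whence `⟪∂ₜW, W⟫ = ⟪∂ₜu, W⟫`
  have hWt' : ∀ x, Torus.timeDerivWithin S W t x = Torus.timeDerivWithin S u t x -
      (Torus.timeDerivWithin S u t x 0) • EuclideanSpace.single (0 : Fin 3) (1 : ℝ) := by
    intro x
    have h1 := hu.hasDerivWithinAt_slice ht x
    have h2 := ((EuclideanSpace.proj (0 : Fin 3) :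
        EuclideanSpace ℝ (Fin 3) →L[ℝ] ℝ).hasFDerivAt.comp_hasDerivWithinAt t h1).smul_const
      (EuclideanSpace.single (0 : Fin 3) (1 : ℝ))
    have h3 := (h1.sub h2).sub_const c
    exact h3.derivWithin (hU t ht)
  have hinner : ∀ x, ⟪Torus.timeDerivWithin S W t x, W t x⟫ = ⟪Torus.timeDerivWithin S u t x, W t x⟫ := by
    intro x
    rw [hWt' x, inner_sub_left, inner_smul_single_crossPlane _ _ hc, sub_zero]
  -- Step 3: insert the momentum equation; the force term drops out pointwise
  have heq : ∀ x, Torus.timeDerivWithin S u t x =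
      ν • laplacian (u t) x - gradient (p t) x + f t x - convect (u t) (u t) x := by
    intro x
    rw [← h.momentum t ht x]
    abel
  have hW0 : ∀ x, ⟪EuclideanSpace.single (0 : Fin 3) (1 : ℝ), W t x⟫ = 0 := fun x => by
    rw [EuclideanSpace.inner_single_left, hWdef]
    simp [hc]
  have hpt' : ∀ x, Torus.timeDerivWithin S (fun s x => ‖W s x‖ ^ 2) t x =
      2 * (ν * ⟪laplacian (u t) x, W t x⟫ - ⟪gradient (p t) x, W t x⟫ -
        ⟪convect (u t) (u t) x, W t x⟫) := by
    intro x
    rw [htd x, hinner x, heq x, hf t x]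
    simp only [inner_sub_left, inner_add_left, real_inner_smul_left, hW0 x, mul_zero, add_zero]
  have iL : Integrable (fun x => ν * ⟪laplacian (u t) x, W t x⟫) volume :=
    (hut.laplacian.inner hWt).integrable.const_mul ν
  have iG : Integrable (fun x => ⟪gradient (p t) x, W t x⟫) volume :=
    (hpt.gradient.inner hWt).integrable
  have iC : Integrable (fun x => ⟪convect (u t) (u t) x, W t x⟫) volume :=
    ((hut.convect hut).inner hWt).integrable
  have hval : ∫ x, Torus.timeDerivWithin S (fun s x => ‖W s x‖ ^ 2) t x =
      -(2 * ν) * gradNormSq (W t) := by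
    have i1 : Integrable (fun x => ν * ⟪laplacian (u t) x, W t x⟫ - ⟪gradient (p t) x, W t x⟫)
        volume := iL.sub iG
    simp_rw [hpt']
    rw [integral_const_mul, integral_sub i1 iC, integral_sub iL iG, integral_const_mul]
    have hL : ∫ x, ⟪laplacian (u t) x, W t x⟫ = -gradNormSq (W t) :=
      integral_inner_laplacian_crossPlane hut hc
    have hG : ∫ x, ⟪gradient (p t) x, W t x⟫ = 0 :=
      integral_inner_gradient_crossPlane hut (h.divFree t ht) (hinv t) hpt c
    have hC : ∫ x, ⟪convect (u t) (u t) x, W t x⟫ = 0 :=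
      integral_inner_convect_crossPlane hut (h.divFree t ht) hc
    rw [hL, hG, hC]
    ring
  rw [hval] at hE
  exact hE

/-- The cross-plane fluctuation has zero mean when the momentum is `c`: `∫ W(t) = 0`. [folklore] -/
theorem hasZeroMean_crossPlane {v : UnitAddTorus (Fin 3) → EuclideanSpace ℝ (Fin 3)}
    (hv : IsSmooth v) (hc : c 0 = 0) (hmom : ∫ x, v x = c) :
    HasZeroMean (fun y => v y - (v y 0) • EuclideanSpace.single (0 : Fin 3) (1 : ℝ) - c) := by
  have hi : Integrable v volume := hv.integrable
  have hi0 : Integrable (fun y => v y 0) volume := (hv.apply 0).integrable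
  have hi1 : Integrable (fun y => (v y 0) • EuclideanSpace.single (0 : Fin 3) (1 : ℝ)) volume :=
    hi0.smul_const _
  have h0 : ∫ y, v y 0 = c 0 := by
    have h := ((EuclideanSpace.proj (0 : Fin 3) :
      EuclideanSpace ℝ (Fin 3) →L[ℝ] ℝ).integral_comp_comm hi)
    simp only [PiLp.proj_apply] at h
    rw [h, hmom]
  have hi2 : Integrable (fun y => v y - (v y 0) • EuclideanSpace.single (0 : Fin 3) (1 : ℝ)) volume :=
    hi.sub hi1
  show ∫ y, (v y - (v y 0) • EuclideanSpace.single (0 : Fin 3) (1 : ℝ) - c) = 0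
  rw [integral_sub hi2 (integrable_const c), integral_sub hi hi1, integral_smul_const, hmom, h0, hc]
  simp

/-- **The cross-plane energy relaxes to zero.** Under the hypotheses of
`hasDerivWithinAt_crossPlaneEnergy`, with `ν > 0` and momentum `∫ u(t) = c` for `t ≥ 0`,
`∫ ‖u(t) − u₀(t) e₀ − c‖² → 0` as `t → ∞` (Poincaré: `d/dt ∫‖W‖² = −2ν‖∇W‖₂² ≤ −8π²ν ∫‖W‖²`). [folklore] -/
theorem tendsto_crossPlaneEnergy_zero (h : IsClassicalNSSolutionOn (Ici 0) ν f u p) (hν : 0 < ν)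
    (hf : ∀ t x, f t x = (f t x 0) • EuclideanSpace.single (0 : Fin 3) (1 : ℝ))
    (hinv : ∀ (t : ℝ) (s : UnitAddCircle) (x : UnitAddTorus (Fin 3)), u t (x + Pi.single 0 s) = u t x)
    (hc : c 0 = 0) (hmom : ∀ t : ℝ, 0 ≤ t → ∫ x, u t x = c) :
    Tendsto
      (fun t => ∫ x, ‖u t x - (u t x 0) • EuclideanSpace.single (0 : Fin 3) (1 : ℝ) - c‖ ^ 2)
      atTop (𝓝 0) := by
  have hu : IsSmoothSpaceTimeOn (Ici 0) u := h.smooth_velocity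
  refine tendsto_zero_of_deriv_le_neg_mul_add (a := 8 * Real.pi ^ 2 * ν) (T₀ := 0)
    (g := fun _ => 0)
    (W' := fun t => -(2 * ν) *
      gradNormSq (fun y => u t y - (u t y 0) • EuclideanSpace.single (0 : Fin 3) (1 : ℝ) - c))
    (by positivity) (fun t ht => hasDerivWithinAt_crossPlaneEnergy h hf hinv hc (mem_Ici.2 ht))
    (fun t ht => ?_) (fun t _ => integral_nonneg fun x => sq_nonneg _) tendsto_const_nhds
  have hWt : IsSmooth (fun y => u t y - (u t y 0) • EuclideanSpace.single (0 : Fin 3) (1 : ℝ) - c) :=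
    isSmooth_crossPlane (hu.isSmooth_slice (mem_Ici.2 ht)) c
  have hP := four_pi_sq_mul_integral_norm_sq_le_gradNormSq hWt
    (hasZeroMean_crossPlane (hu.isSmooth_slice (mem_Ici.2 ht)) hc (hmom t ht))
  nlinarith [hP, hν]

end Time

end LongitudinalQuiet

end Summit.AnomalousDissipation.AnomalousDissipation.Theorems

end
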